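import Literature.NumberTheory.Automorphic.ShimuraParametrizationSplitCaseProofs
import Literature.NumberTheory.Automorphic.ShimuraCurveIdealCountBridge
import Literature.NumberTheory.Automorphic.ShimuraCurveOrbitIdealCount
import Literature.NumberTheory.Automorphic.ShimuraCurveCovolume
import Literature.NumberTheory.Automorphic.ShimuraCurveDivisionLattice
import Literature.NumberTheory.Automorphic.QuaternionIdealCountFactorization
import Literature.NumberTheory.Automorphic.QuaternionLocalSplitIdealCount
import Literature.NumberTheory.Automorphic.EichlerOrderLocallyMaximal
import HarnessLib

/-!
# The degree `ℓ + 1` of the Hecke correspondence `T_ℓ` of `X₀^D(M)` at a good prime: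
# `#(Γ₀^D(M) ∖ ι(O(ℓ))) = ℓ + 1` for EVERY Shimura curve datum, `ℓ ∤ D M`

Topic `NumberTheory/Automorphic`; theorems only (no definition, no named fact, no instance, no
`sorry`). For a Shimura curve datum `X : ShimuraCurveData D M` (`ShimuraCurve.lean`: a quaternion
algebra `B/ℚ` of discriminant `D`, an Eichler order `O` of level `M`, a real splitting `ι`;
`Γ = Γ₀^D(M) = ι(O¹)`; `X.heckeSet n = ι(O(n))`, `X.heckeSetoid n` = left `Γ`-cosets on it, the
index set of the tree's Hecke operator `X.heckeFun n`) and a prime `ℓ ∤ D M`, the coset space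
`Γ ∖ ι(O(ℓ))` is finite with exactly `ℓ + 1` elements
(`ShimuraCurveData.finite_and_natCard_quotient_heckeSetoid`). This is the classical degree of
`T_ℓ` (Shimura 1971 Prop. 3.36; Eichler 1973 Ch. II §6 Cor. 1: the number of integral left
`O`-ideals of reduced norm `ℓ` prime to the level is `ℓ + 1`; Miyake Thm. 5.3.5), assembled from
bricks of the tree along the two branches of the classification:

* `D = 1` (`natCard_quotient_heckeSetoid_of_discr_one`): by the split-case dictionary of
  `ShimuraParametrizationSplitCaseProofs` (`exists_conj_of_discr_one`: `ι(O) = h·{A : M ∣ A₁₀}·h⁻¹`;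
  `existsUnique_heckeIdx_of_mem_heckeSet`: `ι(O(ℓ)) = ⊔ᵢ Γ · hβᵢh⁻¹` over the classical
  representatives `βᵢ ∈ {(1 j; 0 ℓ), diag(ℓ,1)}`, Diamond–Shurman Prop. 5.2.1) the coset space is in
  bijection with the index set `HeckeIdx M ℓ`, of cardinality `ℓ + 1`.
* `D > 1` (`natCard_quotient_heckeSetoid_of_one_lt`): cosets `Γ ι(α)` ↔ principal left ideals `O α`
  with `nrd α = ℓ` (`ShimuraCurveOrbitIdealCount`: `exists_mem_ι_eq_mul`, `exists_mem_Gamma_ι_eq_mul`)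
  ↔ (standard involution) principal right ideals `β O`, `nrd β = ℓ` ↔ (Eichler's theorem
  `exists_eq_units_smul_of_pos`: every invertible integral right ideal is principal with a
  positive-norm generator) invertible integral right `O`-ideals of index `ℓ²`, whose number is
  `a(ℓ) = σ₁(ℓ) = ℓ + 1` (the local count `card_principal_ideals_of_split` of Hermite normal forms in
  `O₍ℓ₎ ≅ M₂(ℤ_ℓ)` through `card_integralIdeals_prime_pow`, exactly as in
  `ShimuraCurveIdealCountAsymptotics.card_integralIdeals_prime_pow_of_not_dvd`, re-derived here because
  that module is outside the built cone).

Filed by the BSD cell `bsd-stepL` (seat `defn-ty1` g41) as the Eichler-level half of the discharge of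
the named fact `Literature.NumberTheory.Automorphic.cartanLevel_card_heckeCosets_eq`
(`ShimuraCurveCartanLevelHeckeDegree.lean`); the Cartan-level half is
`ShimuraCurveCartanLevelHeckeCosets.lean`. Nothing arithmetic is asserted; BSD is proved for no curve.

## References

* G. Shimura, *Introduction to the arithmetic theory of automorphic functions* (1971), Prop. 3.36.
  [cite: ShimuraIATAF1971, Prop. 3.36 and §3.3]
* M. Eichler, *The basis problem for modular forms and the traces of the Hecke operators*, LNM 320
  (1973), Ch. II §6 Cor. 1. [cite: Eichler1973, Ch. II §6 Cor. 1]
* F. Diamond, J. Shurman, *A first course in modular forms*, GTM 228, Prop. 5.2.1.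
  [cite: DiamondShurman2005, Prop. 5.2.1]
* M.-F. Vignéras, *Arithmétique des algèbres de quaternions*, LNM 800 (1980), Ch. III §5 Cor. 5.7,
  Ch. II §2 Thm. 2.3. [cite: VignerasLNM800, Ch. III §5 Cor. 5.7 and Ch. II §2 Thm. 2.3]
-/

noncomputable section

open scoped MatrixGroups Pointwise

namespace Literature.NumberTheory.Automorphic

open Literature.NumberTheory.EllipticCurves.ModularForms (intGL heckeRep HeckeIdx)

namespace ShimuraCurveData

/-! ### 1. The split case `D = 1`: `Γ ∖ ι(O(ℓ)) ≃ I_ℓ(M)` -/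

section DiscrOne

variable {M : ℕ} (X : ShimuraCurveData 1 M)

/-- `#I_ℓ(M) = ℓ + 1` for `ℓ ∤ M` (the index set `HeckeIdx M ℓ` of the classical representatives
`(1 j; 0 ℓ)`, `j mod ℓ`, and `diag(ℓ, 1)`). [cite: DiamondShurman2005, Prop. 5.2.1] -/
theorem card_heckeIdx_of_not_dvd {ℓ : ℕ} [NeZero ℓ] (hℓM : ¬ ℓ ∣ M) :
    Fintype.card (HeckeIdx M ℓ) = ℓ + 1 := by
  rw [Fintype.card_congr (Equiv.subtypeUnivEquiv fun (i : Option (ZMod ℓ)) (_ : i = none) => hℓM),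
    Fintype.card_option, ZMod.card]

/-- **`D = 1`: `Γ₀^1(M) ∖ ι(O(ℓ))` has `ℓ + 1` elements for `ℓ` prime, `ℓ ∤ M`.** With the
conjugator `h` of `exists_conj_of_discr_one` (`ι(O) = h {A : M ∣ A₁₀} h⁻¹`), the classes of the
`h βᵢ h⁻¹`, `i ∈ I_ℓ(M)`, exhaust the coset space without repetition
(`existsUnique_heckeIdx_of_mem_heckeSet`). [cite: DiamondShurman2005, Prop. 5.2.1] [cite: ShimuraIATAF1971, Prop. 3.36] -/
theorem finite_and_natCard_quotient_heckeSetoid_of_discr_one {ℓ : ℕ} (hℓ : ℓ.Prime) (hℓM : ¬ ℓ ∣ M) :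
    Finite (Quotient (X.heckeSetoid ℓ)) ∧ Nat.card (Quotient (X.heckeSetoid ℓ)) = ℓ + 1 := by
  classical
  haveI : NeZero ℓ := ⟨hℓ.ne_zero⟩
  obtain ⟨-, h, -, H⟩ := X.exists_conj_of_discr_one
  have hΓ := X.conjAct_inv_smul_Gamma_eq_of_conj H
  set T : HeckeIdx M ℓ → X.heckeSet ℓ := fun i =>
    ⟨h * intGL (heckeRep ℓ i.1) * h⁻¹, X.conj_intGL_heckeRep_mem_heckeSet H hℓ i⟩ with hT
  set Φ : HeckeIdx M ℓ → Quotient (X.heckeSetoid ℓ) := fun i =>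
    Quotient.mk (X.heckeSetoid ℓ) (T i) with hΦdef
  have hΦ : Function.Bijective Φ := by
    constructor
    · intro i j hij
      obtain ⟨γ, hγ, hγeq⟩ := Quotient.exact hij
      obtain ⟨i', -, huniq⟩ := X.existsUnique_heckeIdx_of_mem_heckeSet H hΓ hℓ hℓM (T j).2
      exact (huniq i ⟨γ, hγ, hγeq⟩).trans (huniq j ⟨1, one_mem _, one_mul _⟩).symm
    · intro q
      induction q using Quotient.inductionOn with
      | h s =>
        obtain ⟨i, ⟨γ, hγ, hγeq⟩, -⟩ := X.existsUnique_heckeIdx_of_mem_heckeSet H hΓ hℓ hℓM s.2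
        exact ⟨i, Quotient.sound ⟨γ, hγ, by rw [hγeq]⟩⟩
  have e : HeckeIdx M ℓ ≃ Quotient (X.heckeSetoid ℓ) := Equiv.ofBijective Φ hΦ
  refine ⟨Finite.of_equiv _ e, ?_⟩
  rw [← Nat.card_congr e, Nat.card_eq_fintype_card, card_heckeIdx_of_not_dvd hℓM]

end DiscrOne

/-! ### 2. The case `D > 1`: cosets, principal left ideals of norm `ℓ`, invertible right ideals of index `ℓ²` -/

section OneLt

variable {D M : ℕ} (X : ShimuraCurveData D M)

/-- An element of `ι(O(n))` is `ι(x)` with `x ∈ O` of reduced norm `n` (`det ∘ ι = nrd`).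
[cite: VignerasLNM800, Ch. I §1 Lemme 1.1] -/
theorem exists_mem_O_reducedNorm_eq_of_mem_heckeSet {n : ℕ} {g : GL (Fin 2) ℝ} (hg : g ∈ X.heckeSet n) :
    ∃ x ∈ X.O, X.ι x = (g : Matrix (Fin 2) (Fin 2) ℝ) ∧ reducedNorm ℚ X.B x = n := by
  obtain ⟨⟨x, hx, hxg⟩, hdet⟩ := hg
  refine ⟨x, hx, hxg, ?_⟩
  have h : ((reducedNorm ℚ X.B x : ℚ) : ℝ) = (n : ℝ) := by rw [← X.det_ι, hxg, hdet]
  exact_mod_cast h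

/-- For `α ∈ O` of reduced norm `n ≠ 0`, the element of `GL₂(ℝ)` with matrix `ι(α)` lies in `ι(O(n))`
(`det ∘ ι = nrd`). [cite: VignerasLNM800, Ch. I §1 Lemme 1.1] -/
theorem exists_heckeSet_coe_eq_ι_of_reducedNorm_eq {n : ℕ} (hn : n ≠ 0) {α : X.B} (hα : α ∈ X.O)
    (hnα : reducedNorm ℚ X.B α = n) :
    ∃ g : GL (Fin 2) ℝ, g ∈ X.heckeSet n ∧ (g : Matrix (Fin 2) (Fin 2) ℝ) = X.ι α := by
  obtain ⟨g, hg⟩ := X.exists_gl_val_eq_ι (α := α) (by rw [hnα]; exact_mod_cast hn)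
  refine ⟨g, ⟨⟨α, hα, hg.symm⟩, ?_⟩, hg⟩
  rw [hg, X.det_ι, hnα]; push_cast; rfl

/-- **Cosets ↔ principal left ideals.** For `n ≠ 0` the coset space `Γ ∖ ι(O(n))` is in bijection
with the set of principal left ideals `O α`, `α ∈ O`, `nrd α = n` (as subsets of `B`): the class of
`ι(α)` goes to `O α`; generators of the same left ideal with the same (positive) norm differ by a unit
of norm `1`, i.e. by `Γ` (`exists_mem_Gamma_ι_eq_mul`), and `Γ`-translates generate the same ideal
(`exists_mem_ι_eq_mul`). [cite: VignerasLNM800, Ch. IV §1 (proof of Thm. 1.1)] -/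
theorem natCard_quotient_heckeSetoid_eq_natCard_leftIdeals {n : ℕ} (hn : n ≠ 0) :
    Nat.card (Quotient (X.heckeSetoid n)) =
      Nat.card {I : Set X.B | ∃ α ∈ X.O, reducedNorm ℚ X.B α = n ∧
        I = (fun o : X.B => o * α) '' (X.O : Set X.B)} := by
  classical
  set S : Set (Set X.B) := {I : Set X.B | ∃ α ∈ X.O, reducedNorm ℚ X.B α = n ∧
    I = (fun o : X.B => o * α) '' (X.O : Set X.B)} with hS
  have hnpos : (0 : ℚ) < n := by exact_mod_cast Nat.pos_of_ne_zero hn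
  -- the generator attached to an element of `ι(O(n))`
  have hgen : ∀ s : X.heckeSet n, ∃ x ∈ X.O, X.ι x = ((s : GL (Fin 2) ℝ) : Matrix (Fin 2) (Fin 2) ℝ) ∧
      reducedNorm ℚ X.B x = n := fun s => X.exists_mem_O_reducedNorm_eq_of_mem_heckeSet s.2
  choose gen hgenO hgenι hgenN using hgen
  set f : X.heckeSet n → S := fun s =>
    ⟨(fun o : X.B => o * gen s) '' (X.O : Set X.B), gen s, hgenO s, hgenN s, rfl⟩ with hf
  -- `f` is constant on cosets
  have hfresp : ∀ s s' : X.heckeSet n, (X.heckeSetoid n).r s s' → f s = f s' := by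
    rintro s s' ⟨γ, hγ, hγeq⟩
    obtain ⟨α', hα'O, -, hideal, hια'⟩ := X.exists_mem_ι_eq_mul (hgenO s) hγ
    have hα' : α' = gen s' := X.ι_injective (by
      rw [hια', hgenι s, hgenι s', ← Units.val_mul, hγeq])
    apply Subtype.ext
    change (fun o : X.B => o * gen s) '' (X.O : Set X.B) = (fun o : X.B => o * gen s') '' (X.O : Set X.B)
    rw [← hα', hideal]
  set F : Quotient (X.heckeSetoid n) → S := Quotient.lift f hfresp with hF
  have hF_mk : ∀ s, F (Quotient.mk _ s) = f s := fun s => rfl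
  have hFbij : Function.Bijective F := by
    constructor
    · intro q q' hqq'
      induction q using Quotient.inductionOn with
      | h s =>
        induction q' using Quotient.inductionOn with
        | h s' =>
          rw [hF_mk, hF_mk] at hqq'
          have heq : (fun o : X.B => o * gen s) '' (X.O : Set X.B) =
              (fun o : X.B => o * gen s') '' (X.O : Set X.B) := congrArg Subtype.val hqq'
          obtain ⟨γ, hγ, hγeq⟩ := X.exists_mem_Gamma_ι_eq_mul (α := gen s) (β := gen s')
            (by rw [hgenN s]; exact hnpos) (by rw [hgenN s']; exact hnpos) heq
          refine Quotient.sound ⟨γ, hγ, Units.ext ?_⟩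
          rw [Units.val_mul, ← hgenι s, ← hγeq, hgenι s']
    · rintro ⟨I, α, hαO, hαn, rfl⟩
      obtain ⟨g, hg, hgα⟩ := X.exists_heckeSet_coe_eq_ι_of_reducedNorm_eq hn hαO hαn
      refine ⟨Quotient.mk _ ⟨g, hg⟩, ?_⟩
      rw [hF_mk]
      apply Subtype.ext
      have hx : gen ⟨g, hg⟩ = α := X.ι_injective (by rw [hgenι, hgα])
      change (fun o : X.B => o * gen ⟨g, hg⟩) '' (X.O : Set X.B) = (fun o : X.B => o * α) '' (X.O : Set X.B)
      rw [hx]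
  exact Nat.card_congr (Equiv.ofBijective F hFbij)

/-- `#{O α : nrd α = n} = #{β O : nrd β = n}` (generators in `O`): the standard involution
exchanges the two families (`(O α)‾ = ᾱ O`, `nrd ᾱ = nrd α`; orders are stable under the involution,
Vignéras I §4 Lemme 4.12). [cite: VignerasLNM800, Ch. I §4 Lemme 4.12] -/
theorem natCard_leftIdeals_eq_natCard_rightIdeals_of_eq (n : ℕ) :
    Nat.card {I : Set X.B | ∃ α ∈ X.O, reducedNorm ℚ X.B α = n ∧
        I = (fun o : X.B => o * α) '' (X.O : Set X.B)} =
      Nat.card {J : Set X.B | ∃ β ∈ X.O, reducedNorm ℚ X.B β = n ∧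
        J = (fun o : X.B => β * o) '' (X.O : Set X.B)} := by
  classical
  set σ : Set X.B → Set X.B := fun S => standardInvolution ℚ X.B '' S with hσ
  have hinv : Function.Involutive σ := fun S => by
    simp only [hσ, Set.image_image, standardInvolution_standardInvolution, Set.image_id']
  refine Nat.card_congr ?_
  refine Equiv.ofBijective (fun I => ⟨σ I.1, ?_⟩) ⟨?_, ?_⟩
  · obtain ⟨α, hαO, hαn, hI⟩ := I.2
    refine ⟨standardInvolution ℚ X.B α, X.isZOrder.standardInvolution_mem hαO, ?_, ?_⟩
    · rw [reducedNorm_standardInvolution, hαn]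
    · rw [hI]; exact X.image_standardInvolution_leftIdeal α
  · intro I I' h
    have h' : σ I.1 = σ I'.1 := congrArg Subtype.val h
    exact Subtype.ext (hinv.injective h')
  · rintro ⟨J, β, hβO, hβn, rfl⟩
    refine ⟨⟨σ ((fun o : X.B => β * o) '' (X.O : Set X.B)), standardInvolution ℚ X.B β,
      X.isZOrder.standardInvolution_mem hβO, ?_, ?_⟩, ?_⟩
    · rw [reducedNorm_standardInvolution, hβn]
    · exact X.image_standardInvolution_rightIdeal β
    · apply Subtype.ext
      change σ (σ _) = _
      rw [hinv]

/-- **Principal right ideals `β O`, `nrd β = n`, are exactly the invertible integral right ideals of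
index `n²`** (`D > 1`, `n ≥ 1`; Eichler's theorem `exists_eq_units_smul_of_pos` supplies the
positive-norm generator, `[O : β O] = nrd(β)²` pins its norm). [cite: VignerasLNM800, Ch. III §5 Cor. 5.7] -/
theorem image_coe_integralIdeals_eq_of_eq (hD : 1 < D) (hM : 0 < M) {n : ℕ} (hn : n ≠ 0) :
    (fun I : Submodule ℤ X.B => (I : Set X.B)) ''
        {I : Submodule ℤ X.B | IsInvertibleRightIdeal X.O I ∧ I ≤ X.O ∧
          I.toAddSubgroup.relIndex X.O.toAddSubgroup = n ^ 2} =
      {J : Set X.B | ∃ β ∈ X.O, reducedNorm ℚ X.B β = n ∧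
        J = (fun o : X.B => β * o) '' (X.O : Set X.B)} := by
  classical
  haveI := X.nontrivial_B
  haveI := X.charZero_B
  have hdiv : ∀ x : X.B, x ≠ 0 → IsUnit x := fun x hx => X.isUnit_of_ne_zero hD x hx
  have hZO := X.isZOrder
  have hcoe : ∀ u : (X.B)ˣ, ((u • X.O : Submodule ℤ X.B) : Set X.B) =
      (fun o : X.B => (u : X.B) * o) '' (X.O : Set X.B) := fun u => by
    rw [Units.smul_def, Submodule.coe_pointwise_smul, ← Set.image_smul]
    rfl
  have hidx : ∀ u : (X.B)ˣ, (u : X.B) ∈ X.O →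
      (((u • X.O).toAddSubgroup.relIndex X.O.toAddSubgroup : ℕ) : ℚ) = reducedNorm ℚ X.B u ^ 2 := by
    intro u hu
    have hleft : (u : X.B) ∈ Brandt.leftOrder X.O := by rw [hZO.toIsOrder.leftOrder_eq]; exact hu
    exact Brandt.cast_relIndex_units_smul_eq_reducedNorm_sq hZO.isFullLattice hleft
  have hnpos : (0 : ℚ) < n := by exact_mod_cast Nat.pos_of_ne_zero hn
  ext J
  simp only [Set.mem_image, Set.mem_setOf_eq]
  constructor
  · rintro ⟨I, ⟨hI, hIO, hIn⟩, rfl⟩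
    obtain ⟨u, huO, hpos, rfl⟩ := X.exists_eq_units_smul_of_pos hD hM hI hIO
    refine ⟨u, huO, ?_, hcoe u⟩
    have h := hidx u huO
    rw [hIn] at h
    push_cast at h
    rw [← sq_eq_sq₀ hpos.le hnpos.le, ← h]
  · rintro ⟨β, hβO, hβn, rfl⟩
    have hβ0 : β ≠ 0 := by
      rintro rfl
      rw [reducedNorm_apply_zero] at hβn
      exact hnpos.ne hβn
    set u : (X.B)ˣ := (hdiv β hβ0).unit with hudef
    have hu : (u : X.B) = β := (hdiv β hβ0).unit_spec
    refine ⟨u • X.O, ⟨hZO.isInvertibleRightIdeal_self.units_smul u, ?_, ?_⟩, by rw [hcoe u, hu]⟩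
    · have hleft : (u : X.B) ∈ Brandt.leftOrder X.O := by rw [hZO.toIsOrder.leftOrder_eq, hu]; exact hβO
      exact (Brandt.units_smul_le_iff_mem_leftOrder X.O u).mpr hleft
    · have h := hidx u (hu ▸ hβO)
      rw [hu, hβn] at h
      exact_mod_cast h

/-- **`a(ℓ) = ℓ + 1` at `ℓ ∤ D M`**: the invertible integral right ideals of index `ℓ²` of the Eichler
order number `1 + ℓ` (the order is maximal at `ℓ`, `B` splits at `ℓ`; Hermite normal forms in
`O₍ℓ₎ ≅ M₂(ℤ_ℓ)`, `card_principal_ideals_of_split` with `k = 1`; the `k`-general statement is the tree's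
`ShimuraCurveIdealCountAsymptotics.card_integralIdeals_prime_pow_of_not_dvd`).
[cite: VignerasLNM800, Ch. II §2 Thm. 2.3 (3)] -/
theorem natCard_integralIdeals_sq_of_not_dvd (hD : 1 < D) (hM : 0 < M) {ℓ : ℕ} (hℓ : ℓ.Prime)
    (hℓD : ¬ ℓ ∣ D) (hℓM : ¬ ℓ ∣ M) :
    Nat.card {I : invertibleRightIdeals X.O // (I : Submodule ℤ X.B) ≤ X.O ∧
        (I : Submodule ℤ X.B).toAddSubgroup.relIndex X.O.toAddSubgroup = ℓ ^ 2} = ℓ + 1 := by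
  haveI : Fact ℓ.Prime := ⟨hℓ⟩
  have hdiv : ∀ x : X.B, x ≠ 0 → IsUnit x := fun x hx => X.isUnit_of_ne_zero hD x hx
  have hE : IsEichlerOrder X.O M := isEichlerOrder_iff_brandt.mpr X.isEichlerOrder
  obtain ⟨O₁, hO₁, -, hloc⟩ := hE.exists_isMaximalZOrder_localAt_eq hM.ne' hℓ hℓM
  obtain ⟨φ⟩ := exists_algHom_matrix_of_not_dvd X.mem_ramifiedPlaces_iff hℓD
  obtain ⟨u, hu⟩ := hO₁.exists_conjUnit_localAt_iff hdiv φ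
  have hΛ : ∀ x : X.B, x ∈ localAt ℓ X.O ↔ ∀ i j, ‖AlgHom.conjUnit φ u x i j‖ ≤ 1 := fun x => by
    rw [hloc]; exact hu x
  have h := card_integralIdeals_prime_pow hdiv X.isZOrder hℓ 1
  rw [pow_one, card_principal_ideals_of_split hdiv (AlgHom.conjUnit φ u) X.isZOrder hΛ 1,
    Finset.sum_range_succ, Finset.sum_range_one, pow_zero, pow_one, add_comm] at h
  exact h

/-- **`D > 1`: `Γ₀^D(M) ∖ ι(O(ℓ))` has `ℓ + 1` elements for `ℓ` prime, `ℓ ∤ D M`** — the number of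
principal left ideals of norm `ℓ` is the number `a(ℓ) = ℓ + 1` of invertible integral right ideals of
index `ℓ²`. [cite: Eichler1973, Ch. II §6 Cor. 1] [cite: VignerasLNM800, Ch. III §5 Cor. 5.7 and Ch. II §2 Thm. 2.3] -/
theorem natCard_quotient_heckeSetoid_of_one_lt (hD : 1 < D) (hM : 0 < M) {ℓ : ℕ} (hℓ : ℓ.Prime)
    (hℓD : ¬ ℓ ∣ D) (hℓM : ¬ ℓ ∣ M) :
    Nat.card (Quotient (X.heckeSetoid ℓ)) = ℓ + 1 := by
  classical
  rw [X.natCard_quotient_heckeSetoid_eq_natCard_leftIdeals hℓ.ne_zero,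
    X.natCard_leftIdeals_eq_natCard_rightIdeals_of_eq ℓ, ← X.image_coe_integralIdeals_eq_of_eq hD hM hℓ.ne_zero,
    Nat.card_coe_set_eq, Set.ncard_image_of_injective _ SetLike.coe_injective, ← Nat.card_coe_set_eq,
    ← X.natCard_integralIdeals_sq_of_not_dvd hD hM hℓ hℓD hℓM]
  refine Nat.card_congr ?_
  exact { toFun := fun I => ⟨⟨I.1, I.2.1⟩, I.2.2.1, I.2.2.2⟩
          invFun := fun I => ⟨I.1.1, I.1.2, I.2.1, I.2.2⟩
          left_inv := fun _ => rfl
          right_inv := fun _ => rfl }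

/-- **`D > 1`, with finiteness**: `Γ₀^D(M) ∖ ι(O(ℓ))` is finite with `ℓ + 1` elements (a type of
non-zero `Nat.card` is finite; cf. the tree's `ShimuraCurveData.finite_quotient_heckeSetoid`).
[cite: Eichler1973, Ch. II §6 Cor. 1] -/
theorem finite_and_natCard_quotient_heckeSetoid_of_one_lt (hD : 1 < D) (hM : 0 < M) {ℓ : ℕ}
    (hℓ : ℓ.Prime) (hℓD : ¬ ℓ ∣ D) (hℓM : ¬ ℓ ∣ M) :
    Finite (Quotient (X.heckeSetoid ℓ)) ∧ Nat.card (Quotient (X.heckeSetoid ℓ)) = ℓ + 1 := by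
  have h := X.natCard_quotient_heckeSetoid_of_one_lt hD hM hℓ hℓD hℓM
  exact ⟨Nat.finite_of_card_ne_zero (by rw [h]; exact Nat.succ_ne_zero ℓ), h⟩

end OneLt

/-! ### 3. Every discriminant -/

/-- **`deg T_ℓ = ℓ + 1` on `X₀^D(M)` for every Shimura curve datum and every prime `ℓ ∤ D M`**:
`Γ₀^D(M) ∖ ι(O(ℓ))` is finite with `ℓ + 1` elements (`D = 1` by the split-case dictionary, `D > 1`
by Eichler's theorem and the local count; `D ≥ 1` as `D` is squarefree, `M ≥ 1` as `O` has finite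
index `M` in a maximal order). [cite: ShimuraIATAF1971, Prop. 3.36] [cite: Eichler1973, Ch. II §6 Cor. 1] -/
theorem finite_and_natCard_quotient_heckeSetoid {D M : ℕ} (X : ShimuraCurveData D M) {ℓ : ℕ}
    (hℓ : ℓ.Prime) (hℓDM : ¬ ℓ ∣ D * M) :
    Finite (Quotient (X.heckeSetoid ℓ)) ∧ Nat.card (Quotient (X.heckeSetoid ℓ)) = ℓ + 1 := by
  have hℓD : ¬ ℓ ∣ D := fun h => hℓDM (dvd_mul_of_dvd_left h M)
  have hℓM : ¬ ℓ ∣ M := fun h => hℓDM (dvd_mul_of_dvd_right h D)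
  have hD0 : D ≠ 0 := fun h => by simpa [h] using X.squarefree
  -- `0 < M`: the Eichler order has finite index `M` in a maximal order (as the tree's
  -- `ShimuraCurveData.level_pos`, whose module is outside the imports used here)
  have hM : 0 < M := by
    obtain ⟨O₁, O₂, hO₁, -, -, hidx⟩ := X.isEichlerOrder
    rw [Nat.pos_iff_ne_zero, ← hidx]
    haveI := X.charZero_B
    haveI : IsAddTorsionFree X.B := isAddTorsionFree_of_charZero_module ℚ X.B
    exact relIndex_ne_zero_of_isFullLattice X.isOrder.isFullLattice hO₁.1.isFullLattice.1
  rcases Nat.lt_or_ge 1 D with hD | hD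
  · exact X.finite_and_natCard_quotient_heckeSetoid_of_one_lt hD hM hℓ hℓD hℓM
  · obtain rfl : D = 1 := le_antisymm hD (Nat.one_le_iff_ne_zero.mpr hD0)
    exact X.finite_and_natCard_quotient_heckeSetoid_of_discr_one hℓ hℓM

end ShimuraCurveData

end Literature.NumberTheory.Automorphic

end
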